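import Mathlib.Topology.MetricSpace.HausdorffDistance
import Mathlib.Analysis.SpecificLimits.Basic
import HarnessLib

/-!
# The doubling lemma of Poláčik–Quittner–Souplet (PROVED)

The abstract "doubling" property behind the rescaling method for universal bounds, blow-up rates
and Liouville-type reductions in superlinear elliptic and parabolic problems:

> **Lemma 5.1** (P. Poláčik, P. Quittner, P. Souplet, *Singularity and decay estimates in
> superlinear problems via Liouville-type theorems. Part II: Parabolic equations*, Indiana Univ.
> Math. J. 56 (2007) 879–908, Lemma 5.1 (p. 14), quoting Lemma 5.1 of Part I, Duke Math. J. 139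
> (2007)). Let `(X, d)` be a complete metric space and let `∅ ≠ D ⊂ Σ ⊂ X`, with `Σ` closed. Set
> `Γ = Σ \ D`. Finally let `M : D → (0, ∞)` be bounded on compact subsets of `D` and fix a real
> `k > 0`. If `y ∈ D` is such that `M(y) dist(y, Γ) > 2k` (5.1), then there exists `x ∈ D` such
> that `M(x) dist(x, Γ) > 2k`, `M(x) ≥ M(y)`, and `M(z) ≤ 2M(x)` for all
> `z ∈ D ∩ B̄_X(x, k M⁻¹(x))` (5.2).

In the parabolic applications `X = ℝⁿ⁺¹` with the parabolic distance and `Γ` is (part of) the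
topological boundary of the space–time domain (Remarks 5.2); for Navier–Stokes it is the device
producing near-maximal "doubling cells" and, after rescaling, bounded ETERNAL solutions from a
violated rate (route `TypeTwoEternal` of `NavierStokesRegularity`, items #9 EternalExtraction; the
§B Type-II-exclusion ideation of cell `ns-regularity-ideate`, strengthen lens). Filed by the §B
consumer-side typer as a reusable, fully proved Literature theorem (no named fact).

## Statement as formalised (`polacikQuittnerSouplet_doubling`)

* `X` a complete metric space, `D ⊆ S` with `S` closed, `Γ := S \ D`;
* `M : X → ℝ` with `0 < M x` on `D` and "bounded on compact subsets of `D`":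
  `∀ K ⊆ D, IsCompact K → ∃ C, ∀ x ∈ K, M x ≤ C`;
* the distance to `Γ` is Mathlib's extended `Metric.infEDist · Γ ∈ [0, ∞]`, which is `∞` for
  `Γ = ∅` — so (5.1), written `ENNReal.ofReal (2k / M y) < infEDist y Γ` (equivalent to
  `M(y) dist(y,Γ) > 2k` as `M(y) > 0`), holds automatically when `Γ = ∅` (`D = S`), as in the
  paper's convention `dist(y, ∅) = ∞`;
* conclusion: `x ∈ D` with `ofReal (2k / M x) < infEDist x Γ`, `M y ≤ M x`, and `M z ≤ 2 M x` for
  all `z ∈ D` with `dist z x ≤ k / M x` (the CLOSED ball, which is what the printed proof gives and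
  is at least as strong as either reading of `B_X`).

Also recorded: the real-distance corollary for nonempty `Γ` (`…_of_infDist`, hypothesis
`2k / M y < Metric.infDist y Γ`) and the whole-space case `D = S = X` (`…_univ`: no boundary
condition at all — for every `y` there is `x` with `M y ≤ M x` and `M ≤ 2 M x` on `B̄(x, k/M x)`).

## Proof (as printed in Part I, proof of Lemma 5.1)

If the conclusion fails at `x = y`, pick `z ∈ D ∩ B̄(y, k/M(y))` with `M(z) > 2M(y)` and iterate.
Along the resulting sequence `M(yⱼ) ≥ 2ʲ M(y)` and `d(yⱼ, yⱼ₊₁) ≤ k/M(yⱼ) ≤ 2⁻ʲ k/M(y)`, and the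
triangle inequality propagates the invariant `dist(yⱼ, Γ) ≥ δ + 2k/M(yⱼ)` with
`δ := dist(y, Γ) - 2k/M(y) > 0`; so the sequence is Cauchy, converges to some `x_∞ ∈ S` (closed),
`x_∞ ∉ Γ` (all `yⱼ` stay `δ`-far from `Γ`), hence `x_∞ ∈ D`, and `{yⱼ} ∪ {x_∞}` is a compact
subset of `D` on which `M` is unbounded — contradiction.

## Mathlib / tree search

`lean search 'doubling'`: only unrelated doubling identities (Serrin's time doubling
`FunctionSpaces/TimeDoubling`, Karamata, Carleman `BackwardHeatGradientDoubling`); no PQS lemma.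
Mathlib: `Metric.infEDist`, `cauchySeq_of_le_geometric`, `cauchySeq_tendsto_of_complete`,
`Filter.Tendsto.isCompact_insert_range`, `IsClosed.mem_of_tendsto`.
-/

noncomputable section

open _root_.Set _root_.Filter _root_.Metric _root_.Topology
open scoped _root_.ENNReal _root_.Topology

namespace Literature.Analysis.PDE

section Doubling

variable {X : Type*} [MetricSpace X]

/-- One step of the doubling iteration: if `z ∈ D` lies in the closed ball `B̄(x, k/M(x))` and
`M(z) > 2M(x)`, then the invariant `δ + 2k/M(x) ≤ dist(x, Γ)` passes to `z`
(`dist(z,Γ) ≥ dist(x,Γ) - k/M(x) ≥ δ + k/M(x) ≥ δ + 2k/M(z)`).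
[cite: PolacikQuittnerSouplet2007, Lemma 5.1 (proof)] -/
theorem doubling_invariant_step {Γ : Set X} {M : X → ℝ} {k : ℝ} {δ : ℝ≥0∞} (hk : 0 < k)
    {x z : X} (hMx : 0 < M x) (hinv : δ + ENNReal.ofReal (2 * k / M x) ≤ infEDist x Γ)
    (hzx : dist z x ≤ k / M x) (hMz : 2 * M x < M z) :
    δ + ENNReal.ofReal (2 * k / M z) ≤ infEDist z Γ := by
  have hMz0 : 0 < M z := by linarith
  have hkx : 0 ≤ k / M x := div_nonneg hk.le hMx.le
  -- `edist z x ≤ k / M x`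
  have hed : edist x z ≤ ENNReal.ofReal (k / M x) := by
    rw [edist_comm]
    exact (edist_le_ofReal hkx).2 hzx
  -- `2k / M z ≤ k / M x`
  have h2 : 2 * k / M z ≤ k / M x := by
    rw [div_le_div_iff₀ hMz0 hMx]
    nlinarith
  -- triangle inequality for `infEDist`
  have htri : infEDist x Γ ≤ infEDist z Γ + ENNReal.ofReal (k / M x) :=
    (infEDist_le_infEDist_add_edist).trans (add_le_add le_rfl hed)
  -- assemble: δ + 2k/Mz + k/Mx ≤ δ + 2k/Mx ≤ infEDist x Γ ≤ infEDist z Γ + k/Mx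
  have hsum : ENNReal.ofReal (2 * k / M z) + ENNReal.ofReal (k / M x) ≤
      ENNReal.ofReal (2 * k / M x) := by
    rw [← ENNReal.ofReal_add (div_nonneg (by linarith) hMz0.le) hkx]
    refine ENNReal.ofReal_le_ofReal ?_
    have : 2 * k / M x = k / M x + k / M x := by ring
    linarith
  have key : δ + ENNReal.ofReal (2 * k / M z) + ENNReal.ofReal (k / M x) ≤
      infEDist z Γ + ENNReal.ofReal (k / M x) := by
    calc δ + ENNReal.ofReal (2 * k / M z) + ENNReal.ofReal (k / M x)
        = δ + (ENNReal.ofReal (2 * k / M z) + ENNReal.ofReal (k / M x)) := add_assoc _ _ _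
      _ ≤ δ + ENNReal.ofReal (2 * k / M x) := add_le_add le_rfl hsum
      _ ≤ infEDist x Γ := hinv
      _ ≤ infEDist z Γ + ENNReal.ofReal (k / M x) := htri
  exact (ENNReal.add_le_add_iff_right ENNReal.ofReal_ne_top).1 key

/-- **Doubling lemma (Poláčik–Quittner–Souplet 2007, Lemma 5.1).** Let `X` be a complete metric
space, `D ⊆ S ⊆ X` with `S` closed, `Γ = S \ D`, `M : X → ℝ` positive on `D` and bounded on every
compact subset of `D`, and `k > 0`. If `y ∈ D` satisfies `M(y) dist(y, Γ) > 2k` — written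
`ofReal (2k / M y) < infEDist y Γ` with the extended distance (automatic if `Γ = ∅`) —, then there
is `x ∈ D` with `M(x) dist(x, Γ) > 2k`, `M(x) ≥ M(y)` and `M(z) ≤ 2M(x)` for all `z ∈ D` with
`dist(z, x) ≤ k / M(x)`. [cite: PolacikQuittnerSouplet2007, Lemma 5.1 (p. 14; Part I Lemma 5.1)] -/
theorem polacikQuittnerSouplet_doubling [CompleteSpace X] {D S : Set X} (hDS : D ⊆ S)
    (hS : IsClosed S)
    {M : X → ℝ} (hMpos : ∀ x ∈ D, 0 < M x)
    (hMbdd : ∀ K : Set X, K ⊆ D → IsCompact K → ∃ C : ℝ, ∀ x ∈ K, M x ≤ C)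
    {k : ℝ} (hk : 0 < k) {y : X} (hy : y ∈ D)
    (hyΓ : ENNReal.ofReal (2 * k / M y) < infEDist y (S \ D)) :
    ∃ x ∈ D, ENNReal.ofReal (2 * k / M x) < infEDist x (S \ D) ∧ M y ≤ M x ∧
      ∀ z ∈ D, dist z x ≤ k / M x → M z ≤ 2 * M x := by
  set Γ : Set X := S \ D with hΓ
  -- the margin `δ = dist(y, Γ) - 2k/M(y) > 0`
  set δ : ℝ≥0∞ := infEDist y Γ - ENNReal.ofReal (2 * k / M y) with hδ
  have hδ0 : δ ≠ 0 := (tsub_pos_iff_lt.2 hyΓ).ne'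
  have hyinv : δ + ENNReal.ofReal (2 * k / M y) ≤ infEDist y Γ :=
    (tsub_add_cancel_of_le hyΓ.le).le
  -- the invariant carried along the iteration
  let P : X → Prop := fun x => x ∈ D ∧ δ + ENNReal.ofReal (2 * k / M x) ≤ infEDist x Γ ∧ M y ≤ M x
  have hPy : P y := ⟨hy, hyinv, le_rfl⟩
  -- from the invariant, the printed condition (5.1) at `x`
  have hP51 : ∀ x, P x → ENNReal.ofReal (2 * k / M x) < infEDist x Γ := by
    rintro x ⟨-, hx, -⟩
    refine lt_of_lt_of_le ?_ hx
    rw [add_comm]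
    exact ENNReal.lt_add_right ENNReal.ofReal_ne_top hδ0
  by_contra hcon
  push Not at hcon
  -- every `x` with the invariant admits a doubling successor
  have hstep : ∀ x, P x → ∃ z, P z ∧ dist z x ≤ k / M x ∧ 2 * M x < M z := by
    intro x hx
    obtain ⟨z, hzD, hzx, hMz⟩ := hcon x hx.1 (hP51 x hx) hx.2.2
    have hMx := hMpos x hx.1
    refine ⟨z, ⟨hzD, doubling_invariant_step hk hMx hx.2.1 hzx hMz, ?_⟩, hzx, hMz⟩
    have := hx.2.2
    nlinarith [hMpos y hy]
  choose! F hF using hstep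
  -- the iterates `yₙ = F^[n] y`
  set u : ℕ → X := fun n => F^[n] y with hu
  have hPu : ∀ n, P (u n) := by
    intro n
    induction n with
    | zero => simpa [hu] using hPy
    | succ n ih =>
      have := (hF (u n) ih).1
      simpa [hu, Function.iterate_succ_apply'] using this
  have hu_succ : ∀ n, u (n + 1) = F (u n) := fun n => by
    simp [hu, Function.iterate_succ_apply']
  have hdist : ∀ n, dist (u (n + 1)) (u n) ≤ k / M (u n) := fun n => by
    rw [hu_succ]; exact (hF (u n) (hPu n)).2.1
  have hgrow : ∀ n, 2 * M (u n) < M (u (n + 1)) := fun n => by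
    rw [hu_succ]; exact (hF (u n) (hPu n)).2.2
  have hMy : 0 < M y := hMpos y hy
  -- `M(uₙ) ≥ 2ⁿ M(y)`
  have hM2 : ∀ n, 2 ^ n * M y ≤ M (u n) := by
    intro n
    induction n with
    | zero => simp [hu]
    | succ n ih =>
      have := hgrow n
      rw [pow_succ]
      nlinarith
  have hMupos : ∀ n, 0 < M (u n) := fun n => hMpos _ (hPu n).1
  -- geometric control of the steps: `dist(uₙ, uₙ₊₁) ≤ (k / M y) (1/2)ⁿ`
  have hgeom : ∀ n, dist (u n) (u (n + 1)) ≤ k / M y * (1 / 2) ^ n := by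
    intro n
    rw [dist_comm]
    refine (hdist n).trans ?_
    have h2n : (0 : ℝ) < 2 ^ n * M y := by positivity
    have hle : k / M (u n) ≤ k / (2 ^ n * M y) := div_le_div_of_nonneg_left hk.le h2n (hM2 n)
    refine hle.trans (le_of_eq ?_)
    rw [one_div_pow]
    field_simp
  have hcauchy : CauchySeq u := cauchySeq_of_le_geometric (1 / 2) (k / M y) (by norm_num) hgeom
  obtain ⟨xlim, hxlim⟩ := cauchySeq_tendsto_of_complete hcauchy
  -- the limit lies in `S` (closed) …
  have hxS : xlim ∈ S :=
    hS.mem_of_tendsto hxlim (Eventually.of_forall fun n => hDS (hPu n).1)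
  -- … and not in `Γ`: all iterates are `δ`-far from `Γ`
  have hfar : ∀ n, δ ≤ infEDist (u n) Γ := fun n =>
    le_trans (self_le_add_right _ _) (hPu n).2.1
  have hxD : xlim ∈ D := by
    by_contra hxD
    have hxΓ : xlim ∈ Γ := ⟨hxS, hxD⟩
    -- `edist (u n) xlim → 0` but `≥ δ > 0`
    have hed : Tendsto (fun n => edist (u n) xlim) atTop (𝓝 0) :=
      (tendsto_iff_edist_tendsto_0.1 hxlim)
    have hev : ∀ᶠ n in atTop, edist (u n) xlim < δ :=
      hed (Iio_mem_nhds (pos_iff_ne_zero.2 hδ0))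
    obtain ⟨n, hn⟩ := hev.exists
    exact (lt_irrefl _) (lt_of_le_of_lt ((hfar n).trans (infEDist_le_edist_of_mem hxΓ)) hn)
  -- `M` is bounded on the compact set `{xlim} ∪ range u ⊆ D`, contradicting `M(uₙ) ≥ 2ⁿ M(y)`
  have hK : IsCompact (insert xlim (range u)) := hxlim.isCompact_insert_range
  have hKD : insert xlim (range u) ⊆ D := by
    rintro w (rfl | ⟨n, rfl⟩)
    · exact hxD
    · exact (hPu n).1
  obtain ⟨C, hC⟩ := hMbdd _ hKD hK
  -- pick `n` with `2ⁿ M y > C`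
  obtain ⟨n, hn⟩ := pow_unbounded_of_one_lt (C / M y) (by norm_num : (1 : ℝ) < 2)
  have h1 : C < 2 ^ n * M y := by rwa [div_lt_iff₀ hMy] at hn
  have h2 : M (u n) ≤ C := hC (u n) (mem_insert_of_mem _ ⟨n, rfl⟩)
  linarith [hM2 n]

/-- **Doubling lemma, real-distance form** (nonempty `Γ`): with `Metric.infDist`, if
`2k / M(y) < infDist y (S \ D)` and `S \ D ≠ ∅`, the same conclusion holds with
`2k / M(x) < infDist x (S \ D)`. [cite: PolacikQuittnerSouplet2007, Lemma 5.1 (p. 14)] -/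
theorem polacikQuittnerSouplet_doubling_of_infDist [CompleteSpace X] {D S : Set X} (hDS : D ⊆ S)
    (hS : IsClosed S)
    {M : X → ℝ} (hMpos : ∀ x ∈ D, 0 < M x)
    (hMbdd : ∀ K : Set X, K ⊆ D → IsCompact K → ∃ C : ℝ, ∀ x ∈ K, M x ≤ C)
    {k : ℝ} (hk : 0 < k) {y : X} (hy : y ∈ D) (hΓ : (S \ D).Nonempty)
    (hyΓ : 2 * k / M y < infDist y (S \ D)) :
    ∃ x ∈ D, 2 * k / M x < infDist x (S \ D) ∧ M y ≤ M x ∧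
      ∀ z ∈ D, dist z x ≤ k / M x → M z ≤ 2 * M x := by
  have hne : infEDist y (S \ D) ≠ ⊤ := (infEDist_ne_top hΓ)
  have hyΓ' : ENNReal.ofReal (2 * k / M y) < infEDist y (S \ D) := by
    rw [infDist, ← ENNReal.ofReal_lt_ofReal_iff_of_nonneg (by positivity [hMpos y hy])] at hyΓ
    rwa [ENNReal.ofReal_toReal hne] at hyΓ
  obtain ⟨x, hxD, hx, hMx, hball⟩ :=
    polacikQuittnerSouplet_doubling hDS hS hMpos hMbdd hk hy hyΓ'
  refine ⟨x, hxD, ?_, hMx, hball⟩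
  have hne' : infEDist x (S \ D) ≠ ⊤ := infEDist_ne_top hΓ
  rw [infDist, ← ENNReal.ofReal_lt_ofReal_iff_of_nonneg (by positivity [hMpos x hxD]),
    ENNReal.ofReal_toReal hne']
  exact hx

/-- **Doubling lemma on the whole space** (`D = S = X`, `Γ = ∅`: Poláčik–Quittner–Souplet 2007,
Lemma 5.1 with empty boundary, the case of entire/eternal solutions): if `M : X → (0,∞)` is
bounded on compact sets and `k > 0`, then for every `y` there is `x` with `M y ≤ M x` and
`M z ≤ 2 M x` whenever `dist z x ≤ k / M x`. [cite: PolacikQuittnerSouplet2007, Lemma 5.1 (p. 14), case `Γ = ∅`] -/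
theorem polacikQuittnerSouplet_doubling_univ [CompleteSpace X] {M : X → ℝ} (hMpos : ∀ x, 0 < M x)
    (hMbdd : ∀ K : Set X, IsCompact K → ∃ C : ℝ, ∀ x ∈ K, M x ≤ C)
    {k : ℝ} (hk : 0 < k) (y : X) :
    ∃ x, M y ≤ M x ∧ ∀ z, dist z x ≤ k / M x → M z ≤ 2 * M x := by
  have h := polacikQuittnerSouplet_doubling (D := (univ : Set X)) (S := univ) subset_rfl
    isClosed_univ (M := M) (fun x _ => hMpos x) (fun K _ hK => hMbdd K hK) hk (mem_univ y)
    (by rw [Set.sdiff_eq_empty.mpr subset_rfl, infEDist_empty]; exact ENNReal.ofReal_lt_top)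
  obtain ⟨x, -, -, hMx, hball⟩ := h
  exact ⟨x, hMx, fun z hz => hball z (mem_univ z) hz⟩

end Doubling

end Literature.Analysis.PDE
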